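import Literature.Computability.AlgebraicComplexity.DeterminantalComplexity
import Literature.Computability.AlgebraicComplexity.PencilFamily

/-!
# The kernel–syzygy untwist is an affine representation (crux `UlrichPadded.OrbitCorankTwo`)

Support file for the crux `UlrichPadded.OrbitCorankTwo` (stmt-ValiantsHypothesis-15032), lemma kit of
line `Sketch-ideator2` (card kernel-syzygy-untwist), made unconditional.  For an affine matrix
`A = A₀ + L` (entries of total degree `≤ 1`), a vector `c` of LINEAR forms in the kernel of the linear
part `L` (`L c = 0`) and a constant vector `e` with `eᵀ c = 0`, the unipotent polynomial gauge
`Q = 1 + c eᵀ` satisfies `Q⁻¹ = 1 - c eᵀ`, `det Q = 1`, and `A · Q = A + (A₀ c) eᵀ` is again affine with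
the same determinant.  This is the inverse of the refuter's Koszul twist (Theorems/UlrichPaddedNoTightInfinityRefutation.lean)
and the size-preserving move behind the numerics of Cruxes/OrbitCorankTwo/ZprobeCycle1.md.
-/

noncomputable section

namespace Summit.ValiantsHypothesis.Theorems

open MvPolynomial Matrix
open Literature.Computability.AlgebraicComplexity

variable {σ : Type*} {m : Type*} [Fintype m] [DecidableEq m]

/-- The rank-one twist `1 + c eᵀ` with `eᵀ c = 0` is unipotent: `(1 + c eᵀ) * (1 - c eᵀ) = 1`. [folklore] -/
theorem untwist_mul_inv (c e : m → MvPolynomial σ ℂ) (he : ∑ i, e i * c i = 0) :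
    (1 + Matrix.of fun i j => c i * e j) * (1 - Matrix.of fun i j => c i * e j) = 1 := by
  -- `of fun i j => c i * e j` is `vecMulVec c e`, whose square vanishes since `e ⬝ᵥ c = 0`
  have hNN : vecMulVec c e * vecMulVec c e = 0 := by
    rw [Matrix.vecMulVec_mul_vecMulVec, show e ⬝ᵥ c = 0 from he, zero_smul,
      Matrix.vecMulVec_zero]
  change (1 + vecMulVec c e) * (1 - vecMulVec c e) = 1
  rw [Matrix.add_mul, Matrix.mul_sub, Matrix.mul_sub, Matrix.one_mul, Matrix.one_mul,
    Matrix.mul_one, hNN, sub_zero, sub_add_cancel]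

/-- Hence `1 + c eᵀ` (with `eᵀ c = 0`) is a unit of the matrix ring, with `det = 1`. [folklore] -/
theorem untwist_isUnit (c e : m → MvPolynomial σ ℂ) (he : ∑ i, e i * c i = 0) :
    IsUnit (1 + Matrix.of fun i j => c i * e j) := by
  have hNN : vecMulVec c e * vecMulVec c e = 0 := by
    rw [Matrix.vecMulVec_mul_vecMulVec, show e ⬝ᵥ c = 0 from he, zero_smul,
      Matrix.vecMulVec_zero]
  refine ⟨⟨_, 1 - Matrix.of fun i j => c i * e j, untwist_mul_inv c e he, ?_⟩, rfl⟩
  -- the two-sided inverse: `(1 - c eᵀ) * (1 + c eᵀ) = 1` as well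
  change (1 - vecMulVec c e) * (1 + vecMulVec c e) = 1
  rw [Matrix.sub_mul, Matrix.mul_add, Matrix.mul_add, Matrix.one_mul, Matrix.one_mul,
    Matrix.mul_one, hNN, add_zero, add_sub_cancel_right]

/-- `det (1 + c eᵀ) = 1` when `eᵀ c = 0` (matrix determinant lemma). [folklore] -/
theorem untwist_det (c e : m → MvPolynomial σ ℂ) (he : ∑ i, e i * c i = 0) :
    (1 + Matrix.of fun i j => c i * e j).det = 1 := by
  change (1 + vecMulVec c e).det = 1
  rw [Matrix.vecMulVec_eq Unit, Matrix.det_one_add_replicateCol_mul_replicateRow,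
    show e ⬝ᵥ c = 0 from he, add_zero]

/-- **The untwist is an affine determinantal representation.**  Let `A` be a square matrix of affine
linear forms with `det A = f`, let `c` be a vector of linear forms killed by the linear part of `A`
(`(of fun a b => homogeneousComponent 1 (A a b)) *ᵥ c = 0`) and `e` a CONSTANT vector with
`∑ e i · c i = 0`.  Then `A * (1 + c · (C ∘ e)ᵀ)` is again a matrix of affine linear forms with
determinant `f`: its entries are `A a b + (A₀ c)_a · e_b` with `A₀` the constant part. [folklore] -/
theorem untwist_isAffineDetRepr (f : MvPolynomial σ ℂ) (A : Matrix m m (MvPolynomial σ ℂ))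
    (hA : IsAffineDetRepr f A) (c : m → MvPolynomial σ ℂ) (hc1 : ∀ i, (c i).IsHomogeneous 1)
    (hc : (Matrix.of fun a b => homogeneousComponent 1 (A a b)).mulVec c = 0)
    (e : m → ℂ) (he : ∑ i, C (e i) * c i = 0) :
    IsAffineDetRepr f (A * (1 + Matrix.of fun i j => c i * C (e j))) := by
  obtain ⟨hdeg, hdet⟩ := hA
  refine ⟨fun a b => ?_, ?_⟩
  · -- the linear part of `A` kills `c` (row `a` of `hc`)
    have hlin : ∑ k, homogeneousComponent 1 (A a k) * c k = 0 := by
      have h := congr_fun hc a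
      exact h
    -- hence `(A c)_a = (A₀ c)_a` is a constant-coefficient combination of the linear forms `c k`
    have hmv : (A *ᵥ c) a = ∑ k, C (coeff 0 (A a k)) * c k := by
      change ∑ k, A a k * c k = _
      calc ∑ k, A a k * c k
          = ∑ k, (C (coeff 0 (A a k)) * c k + homogeneousComponent 1 (A a k) * c k) :=
            Finset.sum_congr rfl fun k _ => by
              rw [← add_mul, ← homogeneousComponent_zero,
                ← eq_homogeneousComponent_zero_add_one (hdeg a k)]
        _ = ∑ k, C (coeff 0 (A a k)) * c k := by
            rw [Finset.sum_add_distrib, hlin, add_zero]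
    -- the `(a, b)` entry of `A * (1 + c eᵀ)` is `A a b + (A₀ c)_a * e_b`
    have hentry :
        (A * (1 + Matrix.of fun i j => c i * C (e j)) : Matrix m m (MvPolynomial σ ℂ)) a b =
          A a b + (∑ k, C (coeff 0 (A a k)) * c k) * C (e b) := by
      change (A * (1 + vecMulVec c fun j => C (e j))) a b = _
      rw [Matrix.mul_add, Matrix.mul_one, Matrix.mul_vecMulVec, Matrix.add_apply,
        Matrix.vecMulVec_apply, hmv]
    rw [hentry]
    -- and it is affine: a sum of products (constant) * (linear form)
    refine (totalDegree_add _ _).trans (max_le (hdeg a b) ?_)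
    refine (totalDegree_mul _ _).trans ?_
    rw [totalDegree_C, add_zero]
    refine totalDegree_finsetSum_le fun k _ => ?_
    refine (totalDegree_mul _ _).trans ?_
    rw [totalDegree_C, zero_add]
    exact (hc1 k).totalDegree_le
  · -- the determinant is unchanged: `det (1 + c eᵀ) = 1`
    rw [Matrix.det_mul, hdet, untwist_det c (fun j => C (e j)) he, mul_one]

/-- **Registered stub form** (crux `UlrichPadded.OrbitCorankTwo`, stmt-ValiantsHypothesis-15032; types of
the crux: variables `Fin n × Fin n`, size `Fin k`): for an affine determinantal representation `A` of
`f`, a vector `c` of linear forms in the kernel of the linear part of `A` and a constant vector `e`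
with `∑ C (e i) * c i = 0`, the one-sided unipotent gauge `Q = 1 + c · (C ∘ e)ᵀ` is a unit and `A * Q`
is again an affine determinantal representation of `f` — so `(P, Q) = (1, Q)` is an admissible pair
in the crux's `∃ P Q, IsUnit P ∧ IsUnit Q ∧ IsAffineDetRepr _ (P * A * Q) ∧ …`. [folklore] -/
theorem orbitCorankTwo_untwist_isAffineDetRepr : ∀ {n k : ℕ} (f : MvPolynomial (Fin n × Fin n) ℂ) (A : Matrix (Fin k) (Fin k) (MvPolynomial (Fin n × Fin n) ℂ)), IsAffineDetRepr f A → ∀ (c : Fin k → MvPolynomial (Fin n × Fin n) ℂ), (∀ i, (c i).IsHomogeneous 1) → (Matrix.of fun a b => MvPolynomial.homogeneousComponent 1 (A a b)).mulVec c = 0 → ∀ (e : Fin k → ℂ), ∑ i, MvPolynomial.C (e i) * c i = 0 → IsUnit (1 + Matrix.of fun i j => c i * MvPolynomial.C (e j)) ∧ IsAffineDetRepr f (A * (1 + Matrix.of fun i j => c i * MvPolynomial.C (e j))) := by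
  intro n k f A hA c hc1 hc e he
  exact ⟨untwist_isUnit c (fun j => C (e j)) he, untwist_isAffineDetRepr f A hA c hc1 hc e he⟩

end Summit.ValiantsHypothesis.Theorems

end
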